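import Mathlib
import Summits.Ventures.HodgeRepro.Tier4.Line1.SpectralOfRTF
import Summits.Ventures.HodgeRepro.Tier4.Common.L1Convolution
import Summits.Ventures.HodgeRepro.Tier4.Line4.SpectralL1Unfold

/-!
# Tier4/Line4/SpectralL1 — §15 (3′): the spectral side of the RTF for an `L¹` first test under the Poincaré clause

Blind re-derivation cell `pub-hodge-repro`, Tier 4 «PROVE THE STEP» (README §9–§10), LINE L4, cut §15 (3′)
`RtfSpectralL1` (lead (R-14) S14858; statement line S14886), seat t4-L2-p3 (gen 4); module 2 of 2 (the assembly).

* `kernel_spectral_L1` — Parseval in `L²(DG)` for `K_{f₁⋆f₂}(x, y) = ∑_j (R(f₂ˇ)φ_j)(y) · conj((R(f̄₁)φ_j)(x))` with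
  `f₁ ∈ L¹ ∩ C` under the Poincaré clause at `x` (module 1's `kernel_left_memLp_of_bound`, `R_cj_eq_L1`,
  `kernel_conv_eq_L1`; the twin of L1-p3's `kernel_spectral`);
* `rtf_spectral_of_kernel_spectral_L1` — the dominated convergence on `DT × DT′` (the twin of L1-p4's
  `rtf_spectral_of_kernel_spectral`: the `f₁`-side continuity / bound / Bessel facts from typer-2's L1Convolution and
  module 1);
* **`rtfSpectralL1_of_poincare`** — §15 (3′): for every character pair, adapted orthonormal family, `f₁ ∈ L¹ ∩ C`
  with the Poincaré clause (α) and `f₂` a test function, `HasSum (fun j => S.specTerm χ χ' φ f₁ f₂ j)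
  (S.J χ χ' (S.conv f₁ f₂))` — the display `RtfSpectralL1` of plan-4's §15 v2 (Assembly-v33 L117) with the ONE added
  hypothesis `PoincareSummable S f₁` (Assembly-v33 L94, stated here in expanded form) on the first test, and
  `[SecondCountableTopology G]`.  WHY THE CLAUSE: without it (3) is FALSE — S14886's counterexample on `ℝ²/ℤ²`.

Mathlib + the landed L1 / Common modules + module 1 only; no printed input; nothing here asserts anything about the
truth of (P); HC_CM is NOT proved by anyone in this repository.
-/

set_option autoImplicit false

noncomputable section

namespace Summit.Ventures.HodgeRepro.Tier4.Line1.RTF.Setting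

open MeasureTheory Topology Filter Summit.Ventures.HodgeRepro.Tier4.Common
  Summit.Ventures.HodgeRepro.Tier4.Line1
open scoped Pointwise ENNReal InnerProductSpace ComplexConjugate

variable {G : Type} [Group G] [TopologicalSpace G] [IsTopologicalGroup G] [MeasurableSpace G] [BorelSpace G]
  (S : Setting G)

/-! ## 1. Parseval: the kernel of `f₁ ⋆ f₂` expands along the adapted family, `f₁ ∈ L¹` -/

/-- **L1.2a for an `L¹` first test** (the twin of L1-p3's `kernel_spectral`): under the Poincaré clause at `x`
(`∑_γ ‖f₁(x⁻¹ γ w)‖ ≤ M` on `DG`), the kernel of `f₁ ⋆ f₂` expands along an adapted orthonormal family,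
`K_{f₁⋆f₂}(x, y) = ∑_j (R(f₂ˇ)φ_j)(y) · conj((R(f̄₁)φ_j)(x))` — Parseval in `L²(DG)` for the kernel vectors
`K_{f₁}(x, ·)` (in `L²` by the Poincaré clause, `kernel_left_memLp_of_bound`) and `conj K_{f₂}(·, y)`, the three inner
products identified by `R_refl_eq`, `R_cj_eq_L1` and `kernel_conv_eq_L1`. -/
theorem kernel_spectral_L1 [SecondCountableTopology G] {τ : ℕ → Set (G → ℂ)} {φ : ℕ → G → ℂ} {n : ℕ → ℕ}
    (hB : S.IsAdaptedONB τ φ n) {f₁ f₂ : G → ℂ} (h₁ : IsTestL1 S f₁) (h₂ : IsTest f₂) (x y : G) {M : ℝ}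
    (hP : ∀ w ∈ S.DG, Summable (fun γ : S.Gk => ‖f₁ (x⁻¹ * γ * w)‖) ∧
      ∑' γ : S.Gk, ‖f₁ (x⁻¹ * γ * w)‖ ≤ M) :
    HasSum (fun j => S.R (refl f₂) (φ j) y * starRingEnd ℂ (S.R (cj f₁) (φ j) x))
      (S.kernel (S.conv f₁ f₂) x y) := by
  haveI := S.haar
  haveI := S.countable_Gk
  haveI := S.isFiniteMeasure_restrict_DG
  -- the family: continuous, invariant, in `L²(DG)`
  have hφc : ∀ j, Continuous (φ j) := fun j => (hB.inv (n j)).cont _ (hB.mem j)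
  have hφi : ∀ j, S.Invariant (φ j) := fun j => (hB.inv (n j)).inv _ (hB.mem j)
  have hφL : ∀ j, MemLp (φ j) 2 (S.μ.restrict S.DG) := fun j =>
    S.memLp_of_inner_self_eq_one (hφc j) (by simpa using hB.orth j j)
  let v : ℕ → Lp ℂ 2 (S.μ.restrict S.DG) := fun j => (hφL j).toLp (φ j)
  -- the inner product of two `toLp`'s is the `L²(DG)` integral
  have hinner : ∀ (a b : G → ℂ) (ha : MemLp a 2 (S.μ.restrict S.DG))
      (hb : MemLp b 2 (S.μ.restrict S.DG)),
      ⟪ha.toLp a, hb.toLp b⟫_ℂ = ∫ w in S.DG, b w * starRingEnd ℂ (a w) ∂S.μ := by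
    intro a b ha hb
    rw [L2.inner_def]
    apply integral_congr_ae
    filter_upwards [ha.coeFn_toLp, hb.coeFn_toLp] with w hwa hwb
    rw [hwa, hwb, RCLike.inner_apply]
  -- orthonormal
  have hv : Orthonormal ℂ v := by
    rw [orthonormal_iff_ite]
    intro i j
    have h := hB.orth j i
    unfold Setting.inner at h
    show ⟪(hφL i).toLp (φ i), (hφL j).toLp (φ j)⟫_ℂ = _
    rw [hinner, h]
    by_cases hij : i = j
    · simp [hij]
    · simp [hij, Ne.symm hij]
  -- complete
  have hsp : (Submodule.span ℂ (Set.range v))ᗮ = ⊥ := by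
    rw [Submodule.eq_bot_iff]
    intro ψ hψ
    rw [Submodule.mem_orthogonal] at hψ
    have hz : ∀ j, S.inner (ψ : G → ℂ) (φ j) = 0 := by
      intro j
      have h := hψ (v j) (Submodule.subset_span ⟨j, rfl⟩)
      rw [L2.inner_def] at h
      unfold Setting.inner
      rw [← h]
      apply integral_congr_ae
      filter_upwards [(hφL j).coeFn_toLp] with w hw
      show _ = ⟪(v j) w, ψ w⟫_ℂ
      rw [hw, RCLike.inner_apply]
    exact Lp.eq_zero_iff_ae_eq_zero.mpr (hB.complete ψ (Lp.memLp ψ) hz)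
  let b : HilbertBasis ℕ ℂ (Lp ℂ 2 (S.μ.restrict S.DG)) := HilbertBasis.mkOfOrthogonalEqBot hv hsp
  have hb : ∀ j, b j = v j := fun j => by
    simp only [b, HilbertBasis.coe_mkOfOrthogonalEqBot]
  -- the two kernel vectors
  have hA : MemLp (fun w => S.kernel f₁ x w) 2 (S.μ.restrict S.DG) := S.kernel_left_memLp_of_bound h₁.1 x hP
  have hBm : MemLp (fun w => starRingEnd ℂ (S.kernel f₂ w y)) 2 (S.μ.restrict S.DG) :=
    (S.kernel_right_memLp h₂ y).star
  have key := b.hasSum_inner_mul_inner (hBm.toLp _) (hA.toLp _)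
  -- identify the three inner products
  have e1 : ∀ j, ⟪hBm.toLp _, b j⟫_ℂ = S.R (refl f₂) (φ j) y := by
    intro j
    rw [hb, hinner, S.R_refl_eq h₂ (hφc j) (hφi j) y]
    apply setIntegral_congr_fun₀ S.fdG.nullMeasurableSet
    intro w _
    simp only [RCLike.conj_conj, mul_comm]
  have e2 : ∀ j, ⟪b j, hA.toLp _⟫_ℂ = starRingEnd ℂ (S.R (cj f₁) (φ j) x) := by
    intro j
    rw [hb, hinner, S.R_cj_eq_L1 h₁ (hφc j) (hφi j) x, ← integral_conj]
    apply setIntegral_congr_fun₀ S.fdG.nullMeasurableSet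
    intro w _
    simp only [map_mul, RCLike.conj_conj]
  have e3 : ⟪hBm.toLp _, hA.toLp _⟫_ℂ = S.kernel (S.conv f₁ f₂) x y := by
    rw [hinner, S.kernel_conv_eq_L1 h₁ h₂ x y]
    apply setIntegral_congr_fun₀ S.fdG.nullMeasurableSet
    intro w _
    simp only [RCLike.conj_conj]
  simp only [e1, e2, e3] at key
  exact key

/-! ## 2. The integration step: dominated convergence on `DT × DT′` -/

/-- **L1.2b's integration step for an `L¹` first test** (the twin of L1-p4's `rtf_spectral_of_kernel_spectral`): given
the pointwise expansion `hK` at every `(x, y)` and the Poincaré clause (α) for `f₁`, the spectral expansion of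
`J(f₁ ⋆ f₂)` follows by dominated convergence on `DT × DT′`, the terms dominated by
`(‖R(f₂ˇ)φ_j(t′)‖² + ‖R(f̄₁)φ_j(t)‖²)/2`, whose sum is bounded on `DT × DT′` by Bessel (L1-p4's
`exists_bound_tsum_sq_norm_R` for `f₂ˇ`, `exists_bound_tsum_sq_norm_R_L1` for `f̄₁` under the Poincaré clause on
`closure DT × closure DG`); continuity and the trivial bound of `R(f̄₁)φ_j` are typer-2's `continuous_R_of_integrable`
/ `norm_R_le_of_integrable`. -/
theorem rtf_spectral_of_kernel_spectral_L1 [SecondCountableTopology G] {χ : S.T → ℂ} {χ' : S.T' → ℂ}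
    (hχ : S.IsCharacter χ) (hχ' : S.IsCharacter' χ') {τ : ℕ → Set (G → ℂ)} {φ : ℕ → G → ℂ} {n : ℕ → ℕ}
    (hB : S.IsAdaptedONB τ φ n) {f₁ f₂ : G → ℂ} (h₁ : IsTestL1 S f₁)
    (hP : ∀ C₁ C₂ : Set G, IsCompact C₁ → IsCompact C₂ → ∃ M : ℝ, ∀ x ∈ C₁, ∀ y ∈ C₂,
      Summable (fun γ : S.Gk => ‖f₁ (x⁻¹ * γ * y)‖) ∧ ∑' γ : S.Gk, ‖f₁ (x⁻¹ * γ * y)‖ ≤ M)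
    (h₂ : IsTest f₂)
    (hK : ∀ x y : G, HasSum (fun j => S.R (refl f₂) (φ j) y * starRingEnd ℂ (S.R (cj f₁) (φ j) x))
      (S.kernel (S.conv f₁ f₂) x y)) :
    HasSum (fun j => S.periodT' χ' (fun t' => S.R (refl f₂) (φ j) t') *
        starRingEnd ℂ (S.periodT χ (fun t => S.R (cj f₁) (φ j) t)))
      (S.J χ χ' (S.conv f₁ f₂)) := by
  haveI := S.haarT
  haveI := S.haarT'
  -- the finite measures on `DT`, `DT'` and their product
  haveI hνT : IsFiniteMeasure (S.μT.restrict S.DT) := isFiniteMeasure_restrict.mpr S.measure_DT_ne_top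
  haveI hνT' : IsFiniteMeasure (S.μT'.restrict S.DT') :=
    isFiniteMeasure_restrict.mpr S.measure_DT'_ne_top
  set ν : Measure (S.T × S.T') := (S.μT.restrict S.DT).prod (S.μT'.restrict S.DT') with hν
  -- the coefficient functions on `G`
  have hφc : ∀ j, Continuous (φ j) := fun j => (hB.inv (n j)).cont _ (hB.mem j)
  have hφinv : ∀ j, S.Invariant (φ j) := fun j => (hB.inv (n j)).inv _ (hB.mem j)
  have h₁cj : Integrable (cj f₁) S.μ := (IsTestL1.cj S h₁).2
  have hac : ∀ j, Continuous (S.R (cj f₁) (φ j)) := fun j => by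
    obtain ⟨B, -, hBφ⟩ := S.exists_bound_of_invariant (hφinv j) (hφc j)
    exact continuous_R_of_integrable S h₁cj (hφc j) hBφ
  have ha'c : ∀ j, Continuous (S.R (refl f₂) (φ j)) := fun j => by
    obtain ⟨B, -, hBφ⟩ := S.exists_bound_of_invariant (hφinv j) (hφc j)
    exact S.continuous_R h₂.refl (hφc j) hBφ
  have hab : ∀ j, ∃ C : ℝ, ∀ x, ‖S.R (cj f₁) (φ j) x‖ ≤ C := fun j => by
    obtain ⟨B, -, hBφ⟩ := S.exists_bound_of_invariant (hφinv j) (hφc j)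
    exact ⟨_, norm_R_le_of_integrable S h₁cj hBφ⟩
  have ha'b : ∀ j, ∃ C : ℝ, ∀ x, ‖S.R (refl f₂) (φ j) x‖ ≤ C := fun j => by
    obtain ⟨B, -, hBφ⟩ := S.exists_bound_of_invariant (hφinv j) (hφc j)
    exact ⟨_, S.norm_R_le h₂.refl hBφ⟩
  -- the Poincaré clause at a point and on the compact `closure DT`
  have hPpt : ∀ x : G, Summable fun j => ‖S.R (cj f₁) (φ j) x‖ ^ 2 := by
    intro x
    obtain ⟨M, hM⟩ := hP {x} (closure S.DG) isCompact_singleton S.compG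
    exact S.summable_sq_norm_R_L1 h₁ hB x (M := M) fun w hw => hM x (Set.mem_singleton x) w hw
  obtain ⟨M₀, hM₀⟩ := hP ((fun t : S.T => (t : G)) '' closure S.DT) (closure S.DG)
    S.isCompact_image_closure_DT S.compG
  obtain ⟨M₁, -, hM₁⟩ := S.exists_bound_tsum_sq_norm_R_L1 h₁ hB (M := M₀) hM₀
  obtain ⟨M₂, -, hM₂⟩ := S.exists_bound_tsum_sq_norm_R h₂.refl hB S.isCompact_image_closure_DT'
  -- the factors `u j` (on `T'`) and `v j` (on `T`)
  set u : ℕ → S.T' → ℂ := fun j t' => S.R (refl f₂) (φ j) t' * conj (χ' t') with hu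
  set v : ℕ → S.T → ℂ := fun j t => conj (S.R (cj f₁) (φ j) t) * χ t with hv
  have huc : ∀ j, Continuous (u j) := fun j =>
    ((ha'c j).comp continuous_subtype_val).mul (Complex.continuous_conj.comp hχ'.cont)
  have hvc : ∀ j, Continuous (v j) := fun j =>
    (Complex.continuous_conj.comp ((hac j).comp continuous_subtype_val)).mul hχ.cont
  have hui : ∀ j, Integrable (u j) (S.μT'.restrict S.DT') := fun j => by
    obtain ⟨C, hC⟩ := ha'b j
    refine Integrable.mono' (integrable_const C) (huc j).aestronglyMeasurable
      (Eventually.of_forall fun t' => ?_)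
    simp only [hu, norm_mul, RCLike.norm_conj, hχ'.unit, mul_one]
    exact hC _
  have hvi : ∀ j, Integrable (v j) (S.μT.restrict S.DT) := fun j => by
    obtain ⟨C, hC⟩ := hab j
    refine Integrable.mono' (integrable_const C) (hvc j).aestronglyMeasurable
      (Eventually.of_forall fun t => ?_)
    simp only [hv, norm_mul, RCLike.norm_conj, hχ.unit, mul_one]
    exact hC _
  -- the terms `F j` and the limit `H`
  set F : ℕ → S.T × S.T' → ℂ := fun j z => v j z.1 * u j z.2 with hF
  set H : S.T × S.T' → ℂ := fun z =>
    S.kernel (S.conv f₁ f₂) z.1 z.2 * χ z.1 * conj (χ' z.2) with hH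
  -- Step 0a: the term `j` of the statement is `∫ F j dν`
  have hterm : ∀ j, S.periodT' χ' (fun t' => S.R (refl f₂) (φ j) t') *
      conj (S.periodT χ (fun t => S.R (cj f₁) (φ j) t)) = ∫ z, F j z ∂ν := by
    intro j
    rw [hν, hF]
    rw [integral_prod_mul (v j) (u j)]
    unfold Setting.periodT Setting.periodT'
    rw [← integral_conj]
    simp only [hu, hv, map_mul, Complex.conj_conj]
    ring
  -- Step 0c: the pointwise expansion
  have hlim : ∀ z, HasSum (fun j => F j z) (H z) := by
    intro z
    have key := (hK z.1 z.2).mul_right (χ z.1 * conj (χ' z.2))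
    have e1 : (fun j => S.R (refl f₂) (φ j) z.2 * conj (S.R (cj f₁) (φ j) z.1) *
        (χ z.1 * conj (χ' z.2))) = fun j => F j z := by
      ext j
      simp only [hF, hu, hv]
      ring
    have e2 : S.kernel (S.conv f₁ f₂) z.1 z.2 * (χ z.1 * conj (χ' z.2)) = H z := by
      simp only [hH]
      ring
    rw [e1, e2] at key
    exact key
  -- the dominating bound
  set bound : ℕ → S.T × S.T' → ℝ := fun j z =>
    2⁻¹ * (‖S.R (refl f₂) (φ j) z.2‖ ^ 2 + ‖S.R (cj f₁) (φ j) z.1‖ ^ 2) with hbound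
  have hF_meas : ∀ j, AEStronglyMeasurable (F j) ν := fun j =>
    ((hvc j).aestronglyMeasurable.comp_fst).mul ((huc j).aestronglyMeasurable.comp_snd)
  have hb_pt : ∀ j z, ‖F j z‖ ≤ bound j z := by
    intro j z
    simp only [hF, hu, hv, hbound, norm_mul, RCLike.norm_conj, hχ.unit, hχ'.unit, mul_one]
    have := two_mul_le_add_sq ‖S.R (refl f₂) (φ j) z.2‖ ‖S.R (cj f₁) (φ j) z.1‖
    linarith
  have h_bound : ∀ j, ∀ᵐ z ∂ν, ‖F j z‖ ≤ bound j z := fun j => Eventually.of_forall (hb_pt j)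
  have hsumm : ∀ z : S.T × S.T', Summable fun j => bound j z := fun z =>
    ((S.summable_sq_norm_R h₂.refl hB z.2).add (hPpt z.1)).mul_left 2⁻¹
  have bound_summable : ∀ᵐ z ∂ν, Summable fun j => bound j z := Eventually.of_forall hsumm
  -- the uniform bound of the tsum on `DT × DT'`
  have htsum_le : ∀ z : S.T × S.T', z.1 ∈ S.DT → z.2 ∈ S.DT' →
      ∑' j, bound j z ≤ 2⁻¹ * (M₂ + M₁) := by
    intro z h1 h2
    have e : ∑' j, bound j z = 2⁻¹ * (∑' j, ‖S.R (refl f₂) (φ j) z.2‖ ^ 2 +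
        ∑' j, ‖S.R (cj f₁) (φ j) z.1‖ ^ 2) := by
      simp only [hbound]
      rw [tsum_mul_left, Summable.tsum_add (S.summable_sq_norm_R h₂.refl hB z.2) (hPpt z.1)]
    rw [e]
    have hz2 : ((z.2 : S.T') : G) ∈ (fun t : S.T' => (t : G)) '' closure S.DT' :=
      ⟨z.2, subset_closure h2, rfl⟩
    have hz1 : ((z.1 : S.T) : G) ∈ (fun t : S.T => (t : G)) '' closure S.DT :=
      ⟨z.1, subset_closure h1, rfl⟩
    have := hM₂ _ hz2
    have := hM₁ _ hz1
    linarith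
  have hae_mem : ∀ᵐ z ∂ν, z.1 ∈ S.DT ∧ z.2 ∈ S.DT' := by
    have h1 : (S.μT.restrict S.DT) S.DTᶜ = 0 := by
      have := ae_restrict_mem₀ (μ := S.μT) S.fdT.nullMeasurableSet
      rw [ae_iff] at this
      exact this
    have h2 : (S.μT'.restrict S.DT') S.DT'ᶜ = 0 := by
      have := ae_restrict_mem₀ (μ := S.μT') S.fdT'.nullMeasurableSet
      rw [ae_iff] at this
      exact this
    rw [ae_iff]
    have hsub : {z : S.T × S.T' | ¬ (z.1 ∈ S.DT ∧ z.2 ∈ S.DT')} ⊆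
        S.DTᶜ ×ˢ (Set.univ : Set S.T') ∪ (Set.univ : Set S.T) ×ˢ S.DT'ᶜ := by
      intro z hz
      simp only [Set.mem_setOf_eq, not_and_or] at hz
      rcases hz with hz | hz
      · exact Or.inl ⟨hz, Set.mem_univ _⟩
      · exact Or.inr ⟨Set.mem_univ _, hz⟩
    refine measure_mono_null hsub (measure_union_null ?_ ?_)
    · rw [hν, Measure.prod_prod, h1, zero_mul]
    · rw [hν, Measure.prod_prod, h2, mul_zero]
  -- measurability of the tsum of the bound (limit of the partial sums)
  have hbound_meas : ∀ j, AEStronglyMeasurable (bound j) ν := fun j => by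
    have h2 : AEStronglyMeasurable (fun t' : S.T' => ‖S.R (refl f₂) (φ j) t'‖ ^ 2)
        (S.μT'.restrict S.DT') :=
      (((ha'c j).comp continuous_subtype_val).norm.pow 2).aestronglyMeasurable
    have h1 : AEStronglyMeasurable (fun t : S.T => ‖S.R (cj f₁) (φ j) t‖ ^ 2)
        (S.μT.restrict S.DT) :=
      (((hac j).comp continuous_subtype_val).norm.pow 2).aestronglyMeasurable
    exact ((h2.comp_snd).add (h1.comp_fst)).const_mul 2⁻¹
  have htsum_meas : AEStronglyMeasurable (fun z => ∑' j, bound j z) ν := by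
    refine aestronglyMeasurable_of_tendsto_ae atTop
      (f := fun N z => ∑ j ∈ Finset.range N, bound j z)
      (fun N => Finset.aestronglyMeasurable_fun_sum _ fun j _ => hbound_meas j) ?_
    exact Eventually.of_forall fun z => (hsumm z).hasSum.tendsto_sum_nat
  have bound_integrable : Integrable (fun z => ∑' j, bound j z) ν := by
    refine Integrable.mono' (integrable_const (2⁻¹ * (M₂ + M₁))) htsum_meas ?_
    filter_upwards [hae_mem] with z hz
    rw [Real.norm_of_nonneg (tsum_nonneg fun j => by positivity)]
    exact htsum_le z hz.1 hz.2
  -- dominated convergence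
  have hmain := hasSum_integral_of_dominated_convergence bound hF_meas h_bound bound_summable
    bound_integrable (Eventually.of_forall hlim)
  -- `∫ H dν = J`
  have hHmeas : AEStronglyMeasurable H ν := by
    refine aestronglyMeasurable_of_tendsto_ae atTop
      (f := fun N z => ∑ j ∈ Finset.range N, F j z)
      (fun N => Finset.aestronglyMeasurable_fun_sum _ fun j _ => hF_meas j) ?_
    exact Eventually.of_forall fun z => (hlim z).tendsto_sum_nat
  have hHint : Integrable H ν := by
    refine Integrable.mono' bound_integrable hHmeas (Eventually.of_forall fun z => ?_)
    rw [← (hlim z).tsum_eq]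
    have hs : Summable fun j => ‖F j z‖ :=
      Summable.of_nonneg_of_le (fun j => norm_nonneg _) (fun j => hb_pt j z) (hsumm z)
    calc ‖∑' j, F j z‖ ≤ ∑' j, ‖F j z‖ := norm_tsum_le_tsum_norm hs
      _ ≤ ∑' j, bound j z := Summable.tsum_le_tsum (fun j => hb_pt j z) hs (hsumm z)
  have hJ : ∫ z, H z ∂ν = S.J χ χ' (S.conv f₁ f₂) := by
    rw [hν, integral_prod H hHint]
    rfl
  -- conclude
  have e : (fun j => S.periodT' χ' (fun t' => S.R (refl f₂) (φ j) t') *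
      conj (S.periodT χ (fun t => S.R (cj f₁) (φ j) t))) = fun j => ∫ z, F j z ∂ν :=
    funext hterm
  rw [e, ← hJ]
  exact hmain

/-! ## 3. §15 (3′): the spectral side with an `L¹` first test under the Poincaré clause -/

/-- **§15 (3′) — the spectral side of the relative trace formula for an `L¹` FIRST test function** (lead (R-14) S14858;
statement line S14886): for `f₁` continuous and integrable satisfying the Poincaré clause (α) — on every pair of
compacts `C₁`, `C₂` the series `∑_γ ‖f₁(x⁻¹ γ y)‖` is summable and bounded by one constant — and `f₂` a test function
of compact support, `J(f₁ ⋆ f₂) = ∑_j ℓ_{χ′}(R(f₂ˇ)φ_j) · conj ℓ_χ(R(f̄₁)φ_j)` as a `HasSum`: the conclusion of the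
tree's `rtf_spectral` (L1-p4) with `IsTest f₁` weakened to `IsTestL1 f₁` + the Poincaré clause, which is the exact
hypothesis under which `K_{f₁}(x, ·) ∈ L²(DG)` uniformly for `x` in a compact.  Without the clause the statement is
FALSE (S14886: `G = ℝ²`, `G(k) = ℤ²`, `T = T′ = ℝ × {0}`, a Hardy–Littlewood continuous `f₂`-factor and an `L¹ ∩ C`
`f₁`-factor with `|y|^{−2/3}`-periodisation make the series non-summable).  `[SecondCountableTopology G]` makes `G(k)`
countable (the adelic `G` is second countable, `Line1.SecondCountableGA`). -/
theorem rtfSpectralL1_of_poincare [SecondCountableTopology G] {χ : S.T → ℂ} {χ' : S.T' → ℂ}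
    (hχ : S.IsCharacter χ) (hχ' : S.IsCharacter' χ') {τ : ℕ → Set (G → ℂ)} {φ : ℕ → G → ℂ} {n : ℕ → ℕ}
    (hB : S.IsAdaptedONB τ φ n) {f₁ f₂ : G → ℂ} (h₁ : IsTestL1 S f₁)
    (hP : ∀ C₁ C₂ : Set G, IsCompact C₁ → IsCompact C₂ → ∃ M : ℝ, ∀ x ∈ C₁, ∀ y ∈ C₂,
      Summable (fun γ : S.Gk => ‖f₁ (x⁻¹ * γ * y)‖) ∧ ∑' γ : S.Gk, ‖f₁ (x⁻¹ * γ * y)‖ ≤ M)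
    (h₂ : IsTest f₂) :
    HasSum (fun j => S.specTerm χ χ' φ f₁ f₂ j) (S.J χ χ' (S.conv f₁ f₂)) := by
  unfold Setting.specTerm
  refine S.rtf_spectral_of_kernel_spectral_L1 hχ hχ' hB h₁ hP h₂ fun x y => ?_
  obtain ⟨M, hM⟩ := hP {x} (closure S.DG) isCompact_singleton S.compG
  exact S.kernel_spectral_L1 hB h₁ h₂ x y (M := M) fun w hw => hM x (Set.mem_singleton x) w (subset_closure hw)

end Summit.Ventures.HodgeRepro.Tier4.Line1.RTF.Setting

end
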